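import Mathlib.MeasureTheory.Constructions.HaarToSphere
import Mathlib.MeasureTheory.Measure.Haar.InnerProductSpace
import Mathlib.MeasureTheory.Measure.Haar.Unique
import Mathlib.MeasureTheory.Integral.Prod
import Literature.Analysis.FluidPDE.GaussianVortexPlanar

/-!
# Symmetries and bounds for the planar Biot–Savart law

Support file for the proofs in `Literature.Analysis.FluidPDE.GaussianVortexPlanarProofs`
(the `λ = 0` slice of Gallay–Maekawa 2016, Thm. 4.1: the Burgers vortex `αG` solves (4.2)).
Everything here is about `perp`, `biotSavartKernel2D` (`K_{2D}(x) = x^⊥/(2π|x|²)`) and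
`biotSavart2D w = K_{2D} ∗ w` from `GaussianVortexPlanar`, on `ℝ² = EuclideanSpace ℝ (Fin 2)`
(the public lemmas `norm_perp`, `continuous_perp`, `norm_biotSavartKernel2D`,
`measurable_biotSavartKernel2D` live in `GaussianVortexPlanarProofs`; this file keeps private
copies so as not to depend on it):

* `perp` algebra (linearity, `x^⊥⊥ = −x`, skewness, isometry, the completeness relation
  `⟪x,z⟫x + ⟪x^⊥,z⟫x^⊥ = ‖x‖²z` of the frame `{x, x^⊥}`);
* planar isometries as `LinearIsometryEquiv`s, stated as existence theorems:
  rotations `z ↦ az + bz^⊥` (`a² + b² = 1`, commuting with `⊥`) and, for `x ≠ 0`, the reflection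
  fixing the line `ℝx` (anticommuting with `⊥`);
* COVARIANCE of the Biot–Savart law (`biotSavart2D_linearIsometryEquiv`): if `(Tz)^⊥ = εT(z^⊥)`
  and `w ∘ T = w` then `v(Tx) = εTv(x)` for `v = K_{2D} ∗ w` — change of variables `y ↦ Ty`
  (`LinearIsometryEquiv.measurePreserving`) and linearity of the Bochner integral; no
  integrability is needed. Consequences for RADIAL `w` (invariant under all linear isometries):
  `v(0) = 0`, `⟪v(x), x⟫ = 0`, `v(x) = c(x)x^⊥` with `c(x) = ⟪v(x),x^⊥⟫/‖x‖²` rotation invariant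
  — the classical statement that the velocity field of a radial vorticity is purely azimuthal,
  obtained WITHOUT evaluating the Biot–Savart integral;
* `x ↦ v(x)` is strongly measurable (parametric Bochner integral), `‖K_{2D}(z)‖ = (2π‖z‖)⁻¹`,
  `‖z‖⁻¹ ∈ L¹(disc)` (`integrableOn_fun_norm_addHaar`: `r·r⁻¹ = 1`), and the uniform bound
  `‖v(x)‖ ≤ (2π)⁻¹(A ∫𝟙_{‖z‖<1}‖z‖⁻¹ + ‖w‖₁)` for `|w| ≤ A`, `w ∈ L¹`.

## References

* Th. Gallay, C. E. Wayne, *Existence and stability of asymmetric Burgers vortices*, J. Math.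
  Fluid Mech. 9 (2007), (1.3) (`K_{2D}`), (1.5) (`v^G ⟂ ξ`). [GallayWayne2006]
* Th. Gallay, Y. Maekawa, *Existence and stability of viscous vortices*, arXiv:1610.08384, §4,
  (4.2) and the remark `(K_{2D} ∗ G, ∇)G = 0` before (4.12) (PDF p. 16). [GallayMaekawa2016]
-/

noncomputable section

open Set Function Filter MeasureTheory Metric
open scoped InnerProductSpace RealInnerProductSpace Topology

namespace Literature.Analysis.FluidPDE

/-! ### `perp` algebra -/

/-- Coordinates of the inner product on `ℝ²`. [folklore] -/
theorem inner_fin_two (x y : EuclideanSpace ℝ (Fin 2)) : ⟪x, y⟫ = x 0 * y 0 + x 1 * y 1 := by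
  simp [PiLp.inner_apply, Fin.sum_univ_two]; ring

/-- `⊥` is additive. [folklore] -/
theorem perp_add (x y : EuclideanSpace ℝ (Fin 2)) : perp (x + y) = perp x + perp y := by
  ext i; fin_cases i <;> simp [perp]; ring

/-- `⊥` is homogeneous. [folklore] -/
theorem perp_smul (c : ℝ) (x : EuclideanSpace ℝ (Fin 2)) : perp (c • x) = c • perp x := by
  ext i; fin_cases i <;> simp [perp]

/-- `0^⊥ = 0`. [folklore] -/
@[simp] theorem perp_zero : perp 0 = 0 := by
  ext i; fin_cases i <;> simp [perp]

/-- `(−x)^⊥ = −x^⊥`. [folklore] -/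
theorem perp_neg (x : EuclideanSpace ℝ (Fin 2)) : perp (-x) = -perp x := by
  ext i; fin_cases i <;> simp [perp]

/-- `⊥` is subtractive. [folklore] -/
theorem perp_sub (x y : EuclideanSpace ℝ (Fin 2)) : perp (x - y) = perp x - perp y := by
  ext i; fin_cases i <;> simp [perp]; ring

/-- `x^⊥⊥ = −x` (rotation by `π`). [folklore] -/
theorem perp_perp (x : EuclideanSpace ℝ (Fin 2)) : perp (perp x) = -x := by
  ext i; fin_cases i <;> simp [perp]

/-- `x^⊥ ⟂ x`. [folklore] -/
@[simp] theorem inner_perp_self_left (x : EuclideanSpace ℝ (Fin 2)) : ⟪perp x, x⟫ = 0 := by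
  rw [inner_fin_two]; simp; ring

/-- `x ⟂ x^⊥`. [folklore] -/
@[simp] theorem inner_perp_self_right (x : EuclideanSpace ℝ (Fin 2)) : ⟪x, perp x⟫ = 0 := by
  rw [inner_fin_two]; simp; ring

/-- `⊥` preserves inner products. [folklore] -/
@[simp] theorem inner_perp_perp (x y : EuclideanSpace ℝ (Fin 2)) : ⟪perp x, perp y⟫ = ⟪x, y⟫ := by
  rw [inner_fin_two, inner_fin_two]; simp; ring

/-- `⊥` is skew: `⟪x^⊥, y⟫ = −⟪x, y^⊥⟫`. [folklore] -/
theorem inner_perp_left (x y : EuclideanSpace ℝ (Fin 2)) : ⟪perp x, y⟫ = -⟪x, perp y⟫ := by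
  rw [inner_fin_two, inner_fin_two]; simp

/-- `⊥` is an isometry (local copy of `GaussianVortexPlanarProofs.norm_perp`, kept private to
avoid importing that file). [folklore] -/
@[simp] private theorem norm_perp (x : EuclideanSpace ℝ (Fin 2)) : ‖perp x‖ = ‖x‖ := by
  have h : ‖perp x‖ ^ 2 = ‖x‖ ^ 2 := by
    rw [← real_inner_self_eq_norm_sq, ← real_inner_self_eq_norm_sq, inner_perp_perp]
  exact (pow_left_inj₀ (norm_nonneg _) (norm_nonneg _) two_ne_zero).1 h

/-- The completeness relation of the orthogonal frame `{x, x^⊥}` of `ℝ²`: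
`⟪x, z⟫ x + ⟪x^⊥, z⟫ x^⊥ = ‖x‖² z`. [folklore] -/
theorem inner_smul_self_add_inner_perp_smul_perp (x z : EuclideanSpace ℝ (Fin 2)) :
    ⟪x, z⟫ • x + ⟪perp x, z⟫ • perp x = ‖x‖ ^ 2 • z := by
  have hn : ‖x‖ ^ 2 = x 0 ^ 2 + x 1 ^ 2 := by
    rw [EuclideanSpace.norm_sq_eq]; simp [Fin.sum_univ_two]
  rw [inner_fin_two, inner_fin_two, hn]
  ext i; fin_cases i <;> simp [perp] <;> ring

/-- `⊥` is continuous (local copy of `GaussianVortexPlanarProofs.continuous_perp`). [folklore] -/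
private theorem continuous_perp : Continuous perp :=
  ({ toFun := perp, map_add' := perp_add, map_smul' := perp_smul } :
      EuclideanSpace ℝ (Fin 2) →ₗ[ℝ] EuclideanSpace ℝ (Fin 2)).continuous_of_finiteDimensional

/-! ### Planar rotations and reflections as linear isometries -/

/-- **Rotations.** For `a² + b² = 1` the map `z ↦ a z + b z^⊥` (`a = cos θ`, `b = sin θ`) is a
linear isometry equivalence of `ℝ²` (inverse `z ↦ a z − b z^⊥`). [folklore] -/
theorem exists_planarRotation (a b : ℝ) (h : a ^ 2 + b ^ 2 = 1) :
    ∃ R : EuclideanSpace ℝ (Fin 2) ≃ₗᵢ[ℝ] EuclideanSpace ℝ (Fin 2),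
      ∀ z, R z = a • z + b • perp z := by
  let L : ℝ → EuclideanSpace ℝ (Fin 2) →ₗ[ℝ] EuclideanSpace ℝ (Fin 2) := fun c =>
    { toFun := fun z => a • z + c • perp z
      map_add' := fun z w => by rw [perp_add]; module
      map_smul' := fun r z => by rw [perp_smul, RingHom.id_apply]; module }
  have hL : ∀ c z, L c z = a • z + c • perp z := fun c z => rfl
  have hLL : ∀ c z, L c (L (-c) z) = (a * a + c * c) • z := fun c z => by
    simp only [hL, perp_add, perp_smul, perp_perp]; module
  refine ⟨LinearEquiv.isometryOfInner (LinearEquiv.ofLinear (L b) (L (-b)) ?_ ?_) ?_, fun z => rfl⟩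
  · ext1 z
    simp only [LinearMap.coe_comp, comp_apply, LinearMap.id_coe, id_eq]
    rw [hLL, show a * a + b * b = 1 by nlinarith, one_smul]
  · ext1 z
    simp only [LinearMap.coe_comp, comp_apply, LinearMap.id_coe, id_eq]
    have := hLL (-b) z
    rw [neg_neg] at this
    rw [this, show a * a + -b * -b = 1 by nlinarith, one_smul]
  · intro z w
    change ⟪L b z, L b w⟫ = ⟪z, w⟫
    simp only [hL, inner_fin_two, PiLp.add_apply, PiLp.smul_apply, smul_eq_mul, perp_apply_zero,
      perp_apply_one]
    linear_combination (z 0 * w 0 + z 1 * w 1) * h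

/-- Rotations commute with `⊥`. [folklore] -/
theorem perp_rotation_of_eq {R : EuclideanSpace ℝ (Fin 2) ≃ₗᵢ[ℝ] EuclideanSpace ℝ (Fin 2)}
    {a b : ℝ} (hR : ∀ z, R z = a • z + b • perp z) (z : EuclideanSpace ℝ (Fin 2)) :
    perp (R z) = R (perp z) := by
  rw [hR, hR, perp_add, perp_smul, perp_smul, perp_perp, smul_neg]

/-- **Reflections.** For `x ≠ 0` there is a linear isometry equivalence of `ℝ²` fixing `x` and
anticommuting with `⊥`: the reflection `z ↦ ‖x‖⁻² (⟪x, z⟫ x − ⟪x^⊥, z⟫ x^⊥)` across the line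
`ℝ x`. [folklore] -/
theorem exists_planarReflection {x : EuclideanSpace ℝ (Fin 2)} (hx : x ≠ 0) :
    ∃ S : EuclideanSpace ℝ (Fin 2) ≃ₗᵢ[ℝ] EuclideanSpace ℝ (Fin 2),
      S x = x ∧ ∀ z, perp (S z) = -S (perp z) := by
  have hr : ‖x‖ ^ 2 ≠ 0 := by positivity
  let L : EuclideanSpace ℝ (Fin 2) →ₗ[ℝ] EuclideanSpace ℝ (Fin 2) :=
    { toFun := fun z => (‖x‖ ^ 2)⁻¹ • (⟪x, z⟫ • x - ⟪perp x, z⟫ • perp x)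
      map_add' := fun z w => by simp only [inner_add_right]; module
      map_smul' := fun c z => by simp only [inner_smul_right, RingHom.id_apply]; module }
  have hL : ∀ z, L z = (‖x‖ ^ 2)⁻¹ • (⟪x, z⟫ • x - ⟪perp x, z⟫ • perp x) := fun z => rfl
  have h1 : ∀ z, ⟪x, L z⟫ = ⟪x, z⟫ := fun z => by
    simp only [hL, inner_smul_right, inner_sub_right, real_inner_self_eq_norm_sq,
      inner_perp_self_right]
    field_simp
    ring
  have h2 : ∀ z, ⟪perp x, L z⟫ = -⟪perp x, z⟫ := fun z => by
    simp only [hL, inner_smul_right, inner_sub_right, real_inner_self_eq_norm_sq,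
      inner_perp_self_left, norm_perp]
    field_simp
    ring
  have hinv : Involutive L := fun z => by
    conv_lhs => rw [hL]
    rw [h1, h2, neg_smul, sub_neg_eq_add, inner_smul_self_add_inner_perp_smul_perp, smul_smul,
      inv_mul_cancel₀ hr, one_smul]
  refine ⟨LinearEquiv.isometryOfInner (LinearEquiv.ofInvolutive L hinv) ?_, ?_, ?_⟩
  · intro z w
    change ⟪L z, L w⟫ = ⟪z, w⟫
    conv_lhs => rw [hL]
    rw [inner_smul_left, inner_sub_left, inner_smul_left, inner_smul_left, h1, h2]
    have key := congrArg (fun u => ⟪u, w⟫) (inner_smul_self_add_inner_perp_smul_perp x z)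
    simp only [inner_add_left, inner_smul_left, RCLike.conj_to_real] at key
    simp only [RCLike.conj_to_real]
    field_simp
    linear_combination key
  · change L x = x
    rw [hL, real_inner_self_eq_norm_sq, inner_perp_self_left, zero_smul, sub_zero, smul_smul,
      inv_mul_cancel₀ hr, one_smul]
  · intro z
    change perp (L z) = -L (perp z)
    have h : ⟪x, perp z⟫ = -⟪perp x, z⟫ := by rw [inner_perp_left, neg_neg]
    rw [hL, hL, perp_smul, perp_sub, perp_smul, perp_smul, perp_perp, inner_perp_perp, h]
    module

/-! ### Covariance of the Biot–Savart law under planar isometries -/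

/-- `‖K_{2D}(z)‖ = (2π‖z‖)⁻¹ (also at `z = 0`, where both sides vanish); local variant of
`GaussianVortexPlanarProofs.norm_biotSavartKernel2D`. [folklore] -/
private theorem norm_biotSavartKernel2D' (z : EuclideanSpace ℝ (Fin 2)) :
    ‖biotSavartKernel2D z‖ = (2 * Real.pi * ‖z‖)⁻¹ := by
  rw [biotSavartKernel2D, norm_smul, norm_inv, Real.norm_of_nonneg (by positivity), norm_perp]
  by_cases hz : z = 0
  · subst hz; simp
  · have : ‖z‖ ≠ 0 := norm_ne_zero_iff.2 hz
    field_simp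

/-- `K_{2D}` is measurable (local copy of
`GaussianVortexPlanarProofs.measurable_biotSavartKernel2D`). [folklore] -/
private theorem measurable_biotSavartKernel2D : Measurable biotSavartKernel2D := by
  unfold biotSavartKernel2D
  exact ((measurable_const.mul (measurable_norm.pow_const 2)).inv).smul continuous_perp.measurable

/-- `K_{2D}` is a (pseudo-)vector: `K(Tz) = ε T K(z)` for a planar isometry `T` with
`(Tz)^⊥ = ε T(z^⊥)` (`ε = 1` rotations, `ε = −1` reflections). [folklore] -/
theorem biotSavartKernel2D_linearIsometryEquiv
    (T : EuclideanSpace ℝ (Fin 2) ≃ₗᵢ[ℝ] EuclideanSpace ℝ (Fin 2)) {ε : ℝ}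
    (hT : ∀ z, perp (T z) = ε • T (perp z)) (z : EuclideanSpace ℝ (Fin 2)) :
    biotSavartKernel2D (T z) = ε • T (biotSavartKernel2D z) := by
  rw [biotSavartKernel2D, biotSavartKernel2D, LinearIsometryEquiv.norm_map, hT, smul_comm,
    LinearIsometryEquiv.map_smul]

/-- **Covariance of the Biot–Savart law.** For a planar isometry `T` with `(Tz)^⊥ = ε T(z^⊥)` and a
`T`-invariant vorticity `w`, `(K_{2D} ∗ w)(Tx) = ε T (K_{2D} ∗ w)(x)` (change of variables
`y ↦ Ty` and linearity of the Bochner integral; no integrability needed). [folklore] -/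
theorem biotSavart2D_linearIsometryEquiv
    (T : EuclideanSpace ℝ (Fin 2) ≃ₗᵢ[ℝ] EuclideanSpace ℝ (Fin 2)) {ε : ℝ}
    (hT : ∀ z, perp (T z) = ε • T (perp z)) {w : EuclideanSpace ℝ (Fin 2) → ℝ}
    (hw : ∀ y, w (T y) = w y) (x : EuclideanSpace ℝ (Fin 2)) :
    biotSavart2D w (T x) = ε • T (biotSavart2D w x) := by
  unfold biotSavart2D
  have h1 : ∫ y, w (T y) • biotSavartKernel2D (T x - T y) =
      ∫ y, w y • biotSavartKernel2D (T x - y) :=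
    T.measurePreserving.integral_comp (T.toHomeomorph.measurableEmbedding)
      (fun y => w y • biotSavartKernel2D (T x - y))
  rw [← h1]
  simp_rw [hw, ← map_sub, biotSavartKernel2D_linearIsometryEquiv T hT, smul_comm (w _) ε,
    ← LinearIsometryEquiv.map_smul]
  rw [← LinearIsometryEquiv.coe_toContinuousLinearEquiv, ContinuousLinearEquiv.integral_comp_comm,
    integral_smul, LinearIsometryEquiv.coe_toContinuousLinearEquiv, LinearIsometryEquiv.map_smul]

/-! ### Radial vorticities have azimuthal velocity -/

section Radial

variable {w : EuclideanSpace ℝ (Fin 2) → ℝ}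
  (hw : ∀ (T : EuclideanSpace ℝ (Fin 2) ≃ₗᵢ[ℝ] EuclideanSpace ℝ (Fin 2)) (y), w (T y) = w y)
include hw

/-- The velocity of a radial vorticity vanishes at the origin (use `T = −1`). [folklore] -/
theorem biotSavart2D_zero_of_radial : biotSavart2D w 0 = 0 := by
  have hT : ∀ z : (EuclideanSpace ℝ (Fin 2)), perp (LinearIsometryEquiv.neg ℝ z) =
      (1 : ℝ) • LinearIsometryEquiv.neg ℝ (perp z) := fun z => by simp [perp_neg]
  have h := biotSavart2D_linearIsometryEquiv (LinearIsometryEquiv.neg ℝ) hT (hw _) 0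
  simp only [LinearIsometryEquiv.coe_neg, neg_zero, one_smul] at h
  have h2 : (2 : ℝ) • biotSavart2D w 0 = 0 := by
    rw [two_smul]; nth_rw 1 [h]; exact neg_add_cancel _
  exact (smul_eq_zero.mp h2).resolve_left two_ne_zero

/-- **The velocity of a radial vorticity is azimuthal**: `⟪(K_{2D} ∗ w)(x), x⟫ = 0`
(reflection across the line `ℝx`; Gallay–Maekawa 2016 use the special case
`(K_{2D} ∗ G, ∇)G = 0`). [folklore] -/
theorem inner_biotSavart2D_self_of_radial (x : EuclideanSpace ℝ (Fin 2)) :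
    ⟪biotSavart2D w x, x⟫ = 0 := by
  by_cases hx : x = 0
  · simp [hx]
  obtain ⟨S, hSx, hS'⟩ := exists_planarReflection hx
  have hS : ∀ z, perp (S z) = (-1 : ℝ) • S (perp z) := fun z => by rw [hS', neg_one_smul]
  have h := biotSavart2D_linearIsometryEquiv S hS (hw S) x
  rw [hSx, neg_one_smul] at h
  have h3 : S (biotSavart2D w x) = -biotSavart2D w x := (neg_eq_iff_eq_neg.mpr h).symm
  have h2 : ⟪S (biotSavart2D w x), S x⟫ = ⟪biotSavart2D w x, x⟫ := S.inner_map_map _ _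
  rw [hSx, h3, inner_neg_left] at h2
  linarith

/-- For a radial vorticity, `v(x) = c(x) x^⊥` with the azimuthal coefficient
`c(x) = ⟪v(x), x^⊥⟫/‖x‖²` (junk `0/0 = 0` at the origin, where `v(0) = 0`). [folklore] -/
theorem biotSavart2D_eq_smul_perp_of_radial (x : EuclideanSpace ℝ (Fin 2)) :
    biotSavart2D w x = (⟪biotSavart2D w x, perp x⟫ / ‖x‖ ^ 2) • perp x := by
  by_cases hx : x = 0
  · subst hx; simp [biotSavart2D_zero_of_radial hw]
  have hr : ‖x‖ ^ 2 ≠ 0 := by positivity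
  have key := inner_smul_self_add_inner_perp_smul_perp x (biotSavart2D w x)
  rw [real_inner_comm, inner_biotSavart2D_self_of_radial hw, zero_smul, zero_add,
    real_inner_comm] at key
  rw [div_eq_inv_mul, mul_smul, key, smul_smul, inv_mul_cancel₀ hr, one_smul]

/-- The azimuthal coefficient of a radial vorticity is rotation invariant. [folklore] -/
theorem azimuthalCoeff_rotation_of_radial
    {R : EuclideanSpace ℝ (Fin 2) ≃ₗᵢ[ℝ] EuclideanSpace ℝ (Fin 2)} {a b : ℝ}
    (hR : ∀ z, R z = a • z + b • perp z) (x : EuclideanSpace ℝ (Fin 2)) :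
    ⟪biotSavart2D w (R x), perp (R x)⟫ / ‖R x‖ ^ 2 = ⟪biotSavart2D w x, perp x⟫ / ‖x‖ ^ 2 := by
  have hT : ∀ z, perp (R z) = (1 : ℝ) • R (perp z) := fun z => by
    rw [perp_rotation_of_eq hR, one_smul]
  rw [biotSavart2D_linearIsometryEquiv _ hT (hw _), one_smul, perp_rotation_of_eq hR,
    LinearIsometryEquiv.inner_map_map, LinearIsometryEquiv.norm_map]

end Radial

/-- `|c(x)| ‖x‖ ≤ ‖v(x)‖` for the azimuthal coefficient `c(x) = ⟪v(x), x^⊥⟫/‖x‖²`. [folklore] -/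
theorem abs_azimuthalCoeff_mul_norm_le (v x : EuclideanSpace ℝ (Fin 2)) :
    |⟪v, perp x⟫ / ‖x‖ ^ 2| * ‖x‖ ≤ ‖v‖ := by
  by_cases hx : x = 0
  · subst hx; simp
  rw [abs_div, abs_of_pos (by positivity : (0:ℝ) < ‖x‖ ^ 2), div_mul_eq_mul_div,
    div_le_iff₀ (by positivity)]
  calc |⟪v, perp x⟫| * ‖x‖ ≤ ‖v‖ * ‖perp x‖ * ‖x‖ := by
        gcongr; exact abs_real_inner_le_norm _ _
    _ = ‖v‖ * ‖x‖ ^ 2 := by rw [norm_perp]; ring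

/-! ### Measurability and boundedness of the Biot–Savart velocity -/

/-- `x ↦ (K_{2D} ∗ w)(x)` is strongly measurable for measurable `w`. [folklore] -/
theorem stronglyMeasurable_biotSavart2D {w : EuclideanSpace ℝ (Fin 2) → ℝ} (hw : Measurable w) :
    StronglyMeasurable (biotSavart2D w) := by
  unfold biotSavart2D
  apply StronglyMeasurable.integral_prod_right (f := fun x y => w y • biotSavartKernel2D (x - y))
  exact ((hw.comp measurable_snd).smul
    (measurable_biotSavartKernel2D.comp (measurable_fst.sub measurable_snd))).stronglyMeasurable

/-- `‖z‖⁻¹` is integrable on every disc of `ℝ²` (polar coordinates: `r · r⁻¹ = 1`). [folklore] -/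
theorem integrableOn_inv_norm_ball (r : ℝ) :
    IntegrableOn (fun z : EuclideanSpace ℝ (Fin 2) => ‖z‖⁻¹) (ball 0 r) := by
  have h := integrableOn_fun_norm_addHaar (volume : Measure (EuclideanSpace ℝ (Fin 2)))
    (f := fun y : ℝ => y⁻¹) (r := r)
  rw [finrank_euclideanSpace_fin] at h
  refine h.2 ?_
  refine (integrableOn_const (C := (1 : ℝ)) (measure_Ioo_lt_top).ne).congr_fun ?_ measurableSet_Ioo
  intro y hy
  have : y ≠ 0 := hy.1.ne'
  simp [this]

/-- The cut-off majorant `𝟙_{‖z‖<1} ‖z‖⁻¹` is integrable on `ℝ²`. [folklore] -/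
theorem integrable_indicator_inv_norm :
    Integrable (indicator (ball (0 : EuclideanSpace ℝ (Fin 2)) 1) fun z => ‖z‖⁻¹) :=
  (integrableOn_inv_norm_ball 1).integrable_indicator measurableSet_ball

/-- The cut-off majorant is nonnegative. [folklore] -/
theorem indicator_inv_norm_nonneg (z : EuclideanSpace ℝ (Fin 2)) :
    0 ≤ indicator (ball (0 : EuclideanSpace ℝ (Fin 2)) 1) (fun z => ‖z‖⁻¹) z := by
  apply indicator_nonneg; intro z _; positivity

/-- Pointwise majorant of the Biot–Savart integrand: for `|w| ≤ A`,
`|w(y)| (2π‖x−y‖)⁻¹ ≤ (2π)⁻¹ (A 𝟙_{‖x−y‖<1}‖x−y‖⁻¹ + |w(y)|)`. [folklore] -/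
theorem norm_biotSavart_integrand_le {w : EuclideanSpace ℝ (Fin 2) → ℝ} {A : ℝ}
    (hA : ∀ y, |w y| ≤ A) (x y : EuclideanSpace ℝ (Fin 2)) :
    ‖w y • biotSavartKernel2D (x - y)‖ ≤ (2 * Real.pi)⁻¹ *
      (A * indicator (ball (0 : EuclideanSpace ℝ (Fin 2)) 1) (fun z => ‖z‖⁻¹) (x - y) + |w y|) := by
  rw [norm_smul, Real.norm_eq_abs, norm_biotSavartKernel2D', mul_inv, ← mul_assoc,
    mul_comm _ (2 * Real.pi)⁻¹, mul_assoc]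
  gcongr
  have h0 : 0 ≤ |w y| := abs_nonneg _
  by_cases hxy : ‖x - y‖ < 1
  · rw [indicator_of_mem (mem_ball_zero_iff.2 hxy)]
    have : |w y| * ‖x - y‖⁻¹ ≤ A * ‖x - y‖⁻¹ := by gcongr; exact hA y
    linarith
  · have h2 : ‖x - y‖⁻¹ ≤ 1 := inv_le_one_of_one_le₀ (not_lt.1 hxy)
    rw [indicator_of_notMem (by rwa [mem_ball_zero_iff]), mul_zero, zero_add]
    calc |w y| * ‖x - y‖⁻¹ ≤ |w y| * 1 := by gcongr
      _ = |w y| := mul_one _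

/-- **Uniform bound on the Biot–Savart velocity** of a bounded integrable vorticity:
`‖(K_{2D} ∗ w)(x)‖ ≤ (2π)⁻¹ (A ∫ 𝟙_{‖z‖<1}‖z‖⁻¹ dz + ‖w‖_{L¹})`. [folklore] -/
theorem norm_biotSavart2D_le {w : EuclideanSpace ℝ (Fin 2) → ℝ} {A : ℝ} (hwi : Integrable w)
    (hA : ∀ y, |w y| ≤ A) (x : EuclideanSpace ℝ (Fin 2)) :
    ‖biotSavart2D w x‖ ≤ (2 * Real.pi)⁻¹ *
      (A * (∫ z, indicator (ball (0 : EuclideanSpace ℝ (Fin 2)) 1) (fun z => ‖z‖⁻¹) z) +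
        ∫ y, |w y|) := by
  unfold biotSavart2D
  have hint : Integrable fun y => (2 * Real.pi)⁻¹ *
      (A * indicator (ball (0 : EuclideanSpace ℝ (Fin 2)) 1) (fun z => ‖z‖⁻¹) (x - y) + |w y|) :=
    (((integrable_indicator_inv_norm.comp_sub_left x).const_mul A).add hwi.abs).const_mul _
  refine (norm_integral_le_of_norm_le hint
    (Eventually.of_forall (norm_biotSavart_integrand_le hA x))).trans (le_of_eq ?_)
  rw [integral_const_mul, integral_add ((integrable_indicator_inv_norm.comp_sub_left x).const_mul A)
    hwi.abs, integral_const_mul,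
    integral_sub_left_eq_self (indicator (ball (0 : EuclideanSpace ℝ (Fin 2)) 1) fun z => ‖z‖⁻¹)
      volume x]

end Literature.Analysis.FluidPDE
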